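import Literature.Analysis.FluidPDE.OseenKernelBasis
import Literature.Analysis.FluidPDE.OseenKernelJointScaling
import Literature.Analysis.FluidPDE.NSBoundedMildOseenDuhamel
import Literature.Analysis.FunctionSpaces.SmoothParametricIntegralDominated
import HarnessLib

/-!
# The far part of the Oseen Duhamel term is jointly smooth, with explicit derivative bounds

Analysis/FluidPDE support file (everything proved) on the discharge path of the named fact
`Literature.Analysis.FluidPDE.knss2009_local_smoothing` (Koch–Nadirashvili–Seregin–Šverák
2009, Prop. 4.1). For bounded measurable fields `v, w` on the slab `(0, T) × E` and
`0 < t₁ ≤ T`, the **far part** of the Duhamel term `B^1_0(v, w)` (`OseenDuhamelSplit.lean`),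

  `Φ₁(t, x) = ∫_{(0,t₁) × E} K(t - τ, x - y)[v(τ, y), w(τ, y)] d(τ, y)`   (`t > t₁`),

has the kernel time `t - τ > t - t₁ > 0` bounded away from `0`, so that **all space-time
derivatives fall on the kernel** (`K` is jointly `C^∞` on `σ > 0`, `OseenKernelJointSmooth.lean`,
with Gaussian-potential dominators on compact time ranges). Differentiating under the integral
sign (`FunctionSpaces.contDiffOn_integral_of_dominated`):

* `oseenDuhamelFar_dominated_hypotheses`: the three hypotheses of the dominated smooth-dependence
  theorem (a.e. smoothness, measurability of the parameter derivatives via the orthonormal-frame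
  expansion of `OseenKernelBasis.lean`, local domination by `M_v M_w C P(x₀ - y)`);
* `contDiffOn_oseenDuhamelFar`: `Φ₁` is `C^∞` on `(t₁, ∞) × E`;
* `exists_norm_iteratedFDeriv_oseenDuhamelFar_le`: for every `m` there is `C_m` (depending only
  on `m` and `E`) with `‖D^m Φ₁(t, x)‖ ≤ C_m M_v M_w t₁ (t - t₁)^{-1/2-m}` for `t₁ < t ≤ 1` (the
  `L¹` bound `∫ ‖D^m K(σ, ·)‖ ≤ C σ^{-1/2-m}` of `OseenKernelJointScaling.lean`): with `t₁ = t/2`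
  this is the weight-`t^m` smoothing estimate `t^m ‖D^m Φ₁(t, ·)‖ ≤ C √t M_v M_w` of KNSS (4.5).

## References

* G. Koch, N. Nadirashvili, G. Seregin, V. Šverák, Acta Math. 203 (2009) = arXiv:0709.3599, §4
  (4.3)–(4.5), Prop. 4.1 and Remark 4.2. [KochNadirashviliSereginSverak2009]
-/

noncomputable section

open MeasureTheory Set Function Filter Metric Real
open _root_.Topology
open scoped RealInnerProductSpace ContDiff ENNReal

namespace Literature.Analysis.FluidPDE

variable {E : Type*} [NormedAddCommGroup E] [InnerProductSpace ℝ E] [FiniteDimensional ℝ E]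
  [MeasurableSpace E] [BorelSpace E]

variable {T t₁ Mv Mw : ℝ} {v w : ℝ → E → E}

omit [FiniteDimensional ℝ E] [MeasurableSpace E] [BorelSpace E] in
/-- **The parameter derivatives of the far integrand are translates of the kernel's**:
`D^m_p [K(p.1 - τ, p.2 - y)[a, b]](p) = D^m (K(·,·)[a,b])(p.1 - τ, p.2 - y)`. [folklore] -/
theorem iteratedFDeriv_oseenKernel_translate (m : ℕ) (ξ p : ℝ × E) (a b : E) :
    iteratedFDeriv ℝ m (fun q : ℝ × E => oseenKernel (q.1 - ξ.1) (q.2 - ξ.2) a b) p =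
      iteratedFDeriv ℝ m (fun r : ℝ × E => oseenKernel r.1 r.2 a b) (p.1 - ξ.1, p.2 - ξ.2) :=
  iteratedFDeriv_comp_sub (f := fun r : ℝ × E => oseenKernel r.1 r.2 a b) m ξ p

/-- **Hypotheses of the dominated smooth-dependence theorem for the far part.** For bounded
measurable fields on `(0, T) × E` and `0 < t₁ ≤ T`: (i) for a.e. `(τ, y) ∈ (0, t₁) × E` the
integrand `p ↦ K(p.1 - τ, p.2 - y)[v(τ,y), w(τ,y)]` is `C^∞` on `(t₁, ∞) × E`; (ii) its parameter
derivatives are measurable in `(τ, y)`; (iii) near every `p₀` with `p₀.1 > t₁` they are dominated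
by `M_v M_w C P(x₀ - y)` with `P` an integrable Gaussian potential. [folklore] -/
theorem oseenDuhamelFar_dominated_hypotheses (ht₁ : 0 < t₁) (ht₁T : t₁ ≤ T)
    (hv : AEStronglyMeasurable (uncurry v) ((volume : Measure (ℝ × E)).restrict (Ioo 0 T ×ˢ univ)))
    (hw : AEStronglyMeasurable (uncurry w) ((volume : Measure (ℝ × E)).restrict (Ioo 0 T ×ˢ univ)))
    (hMv : 0 ≤ Mv) (hMw : 0 ≤ Mw)
    (hvM : ∀ τ ∈ Ioo 0 T, ∀ y, ‖v τ y‖ ≤ Mv) (hwM : ∀ τ ∈ Ioo 0 T, ∀ y, ‖w τ y‖ ≤ Mw) :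
    (∀ᵐ ξ ∂((volume : Measure (ℝ × E)).restrict (Ioo 0 t₁ ×ˢ univ)),
        ContDiffOn ℝ ∞ (fun p : ℝ × E =>
          oseenKernel (p.1 - ξ.1) (p.2 - ξ.2) (v ξ.1 ξ.2) (w ξ.1 ξ.2)) (Ioi t₁ ×ˢ univ)) ∧
    (∀ m : ℕ, ∀ p ∈ Ioi t₁ ×ˢ (univ : Set E), AEStronglyMeasurable
        (fun ξ : ℝ × E => iteratedFDeriv ℝ m (fun q : ℝ × E =>
          oseenKernel (q.1 - ξ.1) (q.2 - ξ.2) (v ξ.1 ξ.2) (w ξ.1 ξ.2)) p)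
        ((volume : Measure (ℝ × E)).restrict (Ioo 0 t₁ ×ˢ univ))) ∧
    (∀ m : ℕ, ∀ p₀ ∈ Ioi t₁ ×ˢ (univ : Set E), ∃ ε > 0, ∃ g : ℝ × E → ℝ,
        Integrable g ((volume : Measure (ℝ × E)).restrict (Ioo 0 t₁ ×ˢ univ)) ∧
        ∀ᵐ ξ ∂((volume : Measure (ℝ × E)).restrict (Ioo 0 t₁ ×ˢ univ)), ∀ p ∈ ball p₀ ε,
          ‖iteratedFDeriv ℝ m (fun q : ℝ × E =>
            oseenKernel (q.1 - ξ.1) (q.2 - ξ.2) (v ξ.1 ξ.2) (w ξ.1 ξ.2)) p‖ ≤ g ξ) := by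
  set S : Set (ℝ × E) := Ioo 0 t₁ ×ˢ univ with hS_def
  have hS : MeasurableSet S := measurableSet_Ioo.prod MeasurableSet.univ
  set μ : Measure (ℝ × E) := (volume : Measure (ℝ × E)).restrict S with hμ
  have hae : ∀ᵐ ξ ∂μ, ξ ∈ S := ae_restrict_mem hS
  have hhalf : IsOpen (Ioi (0 : ℝ) ×ˢ (univ : Set E)) := isOpen_Ioi.prod isOpen_univ
  -- translated points lie in the half-space
  have hpos : ∀ {ξ : ℝ × E}, ξ ∈ S → ∀ {p : ℝ × E}, t₁ < p.1 →
      ((p.1 - ξ.1, p.2 - ξ.2) : ℝ × E) ∈ Ioi (0 : ℝ) ×ˢ (univ : Set E) := by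
    intro ξ hξ p hp
    exact mk_mem_prod (mem_Ioi.2 (sub_pos.2 ((mem_prod.1 hξ).1.2.trans hp))) (mem_univ _)
  -- bounds on the fields on `S`
  have hsub : S ⊆ Ioo 0 T ×ˢ univ := prod_mono (Ioo_subset_Ioo_right ht₁T) subset_rfl
  have hvS : ∀ ξ ∈ S, ‖v ξ.1 ξ.2‖ ≤ Mv := fun ξ hξ => hvM ξ.1 (Ioo_subset_Ioo_right ht₁T (mem_prod.1 hξ).1) ξ.2
  have hwS : ∀ ξ ∈ S, ‖w ξ.1 ξ.2‖ ≤ Mw := fun ξ hξ => hwM ξ.1 (Ioo_subset_Ioo_right ht₁T (mem_prod.1 hξ).1) ξ.2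
  have hvm : AEStronglyMeasurable (fun ξ : ℝ × E => v ξ.1 ξ.2) μ :=
    hv.mono_measure (Measure.restrict_mono hsub le_rfl)
  have hwm : AEStronglyMeasurable (fun ξ : ℝ × E => w ξ.1 ξ.2) μ :=
    hw.mono_measure (Measure.restrict_mono hsub le_rfl)
  set e := stdOrthonormalBasis ℝ E with he_def
  refine ⟨?_, ?_, ?_⟩
  · -- (i) smoothness for a.e. `ξ`
    filter_upwards [hae] with ξ hξ
    have hsubm : ContDiffOn ℝ ∞ (fun p : ℝ × E => p - ξ) (Ioi t₁ ×ˢ univ) :=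
      contDiffOn_id.sub contDiffOn_const
    have h := (contDiffOn_oseenKernel_prod (E := E) (v ξ.1 ξ.2) (w ξ.1 ξ.2)).comp hsubm
      (fun p hp => hpos hξ (mem_prod.1 hp).1)
    exact h
  · -- (ii) measurability of the parameter derivatives (frame expansion)
    intro m p hp
    have hp1 : t₁ < p.1 := (mem_prod.1 hp).1
    have heq : ∀ ξ ∈ S, iteratedFDeriv ℝ m (fun q : ℝ × E =>
        oseenKernel (q.1 - ξ.1) (q.2 - ξ.2) (v ξ.1 ξ.2) (w ξ.1 ξ.2)) p =
        ∑ α, ∑ β, (⟪v ξ.1 ξ.2, e α⟫ * ⟪w ξ.1 ξ.2, e β⟫) •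
          iteratedFDeriv ℝ m (fun r : ℝ × E => oseenKernel r.1 r.2 (e α) (e β)) (p.1 - ξ.1, p.2 - ξ.2) := by
      intro ξ hξ
      rw [iteratedFDeriv_oseenKernel_translate, iteratedFDeriv_oseenKernel_prod_eq_sum e _ _ m (hpos hξ hp1)]
    have hK : ∀ α β, AEStronglyMeasurable (fun ξ : ℝ × E =>
        iteratedFDeriv ℝ m (fun r : ℝ × E => oseenKernel r.1 r.2 (e α) (e β)) (p.1 - ξ.1, p.2 - ξ.2)) μ := by
      intro α β
      have hcont : ContinuousOn (fun ξ : ℝ × E =>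
          iteratedFDeriv ℝ m (fun r : ℝ × E => oseenKernel r.1 r.2 (e α) (e β)) (p.1 - ξ.1, p.2 - ξ.2)) S :=
        (continuousOn_iteratedFDeriv_oseenKernel_prod m (e α) (e β)).comp (by fun_prop)
          fun ξ hξ => hpos hξ hp1
      exact hcont.aestronglyMeasurable hS
    have hsum : AEStronglyMeasurable (fun ξ : ℝ × E => ∑ α, ∑ β, (⟪v ξ.1 ξ.2, e α⟫ * ⟪w ξ.1 ξ.2, e β⟫) •
        iteratedFDeriv ℝ m (fun r : ℝ × E => oseenKernel r.1 r.2 (e α) (e β)) (p.1 - ξ.1, p.2 - ξ.2)) μ := by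
      refine Finset.aestronglyMeasurable_fun_sum _ fun α _ => Finset.aestronglyMeasurable_fun_sum _ fun β _ => ?_
      have hc : AEMeasurable (fun ξ : ℝ × E => ⟪v ξ.1 ξ.2, e α⟫ * ⟪w ξ.1 ξ.2, e β⟫) μ :=
        (hvm.aemeasurable.inner aemeasurable_const).mul (hwm.aemeasurable.inner aemeasurable_const)
      exact hc.aestronglyMeasurable.smul (hK α β)
    refine hsum.congr ?_
    filter_upwards [hae] with ξ hξ
    exact (heq ξ hξ).symm
  · -- (iii) local domination
    intro m p₀ hp₀
    have hp₀1 : t₁ < p₀.1 := (mem_prod.1 hp₀).1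
    set σa : ℝ := (p₀.1 - t₁) / 2 with hσa_def
    set σb : ℝ := p₀.1 + 1 with hσb_def
    have hσa : 0 < σa := by rw [hσa_def]; linarith
    have hab : σa ≤ σb := by rw [hσa_def, hσb_def]; linarith
    obtain ⟨C, hC0, hCb⟩ := exists_norm_iteratedFDeriv_oseenKernelCLM_prod_le (E := E) m hσa hab
    have hσ₁ : 0 < σa / 2 := half_pos hσa
    have hc : 0 < 8 * (σb - σa / 2) := by linarith
    have h2c : 0 < 2 * (8 * (σb - σa / 2)) := by linarith
    set P₂ : E → ℝ := oseenKernelPotential (σa / 2) (2 * (8 * (σb - σa / 2))) with hP₂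
    refine ⟨min σa 1, lt_min hσa one_pos,
      fun ξ => Mv * Mw * (C * Real.exp (2 / (8 * (σb - σa / 2)))) * P₂ (p₀.2 - ξ.2), ?_, ?_⟩
    · -- integrability of the dominator
      have h1 : Integrable (fun _ : ℝ => (1 : ℝ)) ((volume : Measure ℝ).restrict (Ioo 0 t₁)) :=
        integrable_const _
      have h2 : Integrable (fun y : E => P₂ (p₀.2 - y)) (volume : Measure E) :=
        (integrable_oseenKernelPotential hσ₁ h2c).comp_sub_left p₀.2
      have h12 := h1.mul_prod h2
      rw [← volume_restrict_prod_univ_eq_prod] at h12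
      simpa only [one_mul] using h12.const_mul (Mv * Mw * (C * Real.exp (2 / (8 * (σb - σa / 2)))))
    · filter_upwards [hae] with ξ hξ
      intro p hp
      have hξ1 : ξ.1 ∈ Ioo 0 t₁ := (mem_prod.1 hξ).1
      rw [mem_ball, Prod.dist_eq, max_lt_iff, Real.dist_eq, dist_eq_norm] at hp
      obtain ⟨hp1, hp2⟩ := hp
      have hp1' : t₁ < p.1 := by
        have := (abs_lt.1 (hp1.trans_le (min_le_left _ _))).1
        rw [hσa_def] at this; linarith
      -- the kernel time lies in `[σa, σb]`
      have hσ : p.1 - ξ.1 ∈ Icc σa σb := by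
        have h1 := abs_lt.1 (hp1.trans_le (min_le_left _ _))
        have h2 := abs_lt.1 (hp1.trans_le (min_le_right _ _))
        constructor
        · rw [hσa_def] at h1 ⊢; linarith [hξ1.2]
        · rw [hσb_def]; linarith [hξ1.1]
      rw [iteratedFDeriv_oseenKernel_translate]
      have hq := hpos hξ hp1'
      calc ‖iteratedFDeriv ℝ m (fun r : ℝ × E => oseenKernel r.1 r.2 (v ξ.1 ξ.2) (w ξ.1 ξ.2))
              (p.1 - ξ.1, p.2 - ξ.2)‖
          ≤ ‖iteratedFDeriv ℝ m (fun r : ℝ × E => oseenKernelCLM r.1 r.2) (p.1 - ξ.1, p.2 - ξ.2)‖ *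
              ‖v ξ.1 ξ.2‖ * ‖w ξ.1 ξ.2‖ := norm_iteratedFDeriv_oseenKernel_prod_le_CLM m hq _ _
        _ ≤ (C * oseenKernelPotential (σa / 2) (8 * (σb - σa / 2)) (p.2 - ξ.2)) * Mv * Mw := by
            have h0 : 0 ≤ C * oseenKernelPotential (σa / 2) (8 * (σb - σa / 2)) (p.2 - ξ.2) :=
              mul_nonneg hC0 (oseenKernelPotential_nonneg hσ₁.le _ _)
            exact mul_le_mul (mul_le_mul (hCb _ hσ _) (hvS ξ hξ) (norm_nonneg _) h0) (hwS ξ hξ)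
              (norm_nonneg _) (mul_nonneg h0 hMv)
        _ ≤ (C * (Real.exp (2 / (8 * (σb - σa / 2))) * P₂ (p₀.2 - ξ.2))) * Mv * Mw := by
            have hshift : p.2 - ξ.2 = (p₀.2 - ξ.2) + (p.2 - p₀.2) := by abel
            have hle := oseenKernelPotential_add_le hσ₁ hc (p₀.2 - ξ.2) (p.2 - p₀.2)
              (hp2.le.trans (min_le_right _ _))
            rw [← hshift] at hle
            gcongr
        _ = Mv * Mw * (C * Real.exp (2 / (8 * (σb - σa / 2)))) * P₂ (p₀.2 - ξ.2) := by ring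

/-- **The far part of the Duhamel term is jointly `C^∞`** on `(t₁, ∞) × E` (bounded measurable
fields on `(0, T) × E`, `0 < t₁ ≤ T`). KNSS 2009, Remark 4.2 / Prop. 4.1: the smoothing is that of
the kernel. [cite: KochNadirashviliSereginSverak2009, Prop. 4.1 and Remark 4.2 (arXiv:0709.3599 p. 8)] -/
theorem contDiffOn_oseenDuhamelFar (ht₁ : 0 < t₁) (ht₁T : t₁ ≤ T)
    (hv : AEStronglyMeasurable (uncurry v) ((volume : Measure (ℝ × E)).restrict (Ioo 0 T ×ˢ univ)))
    (hw : AEStronglyMeasurable (uncurry w) ((volume : Measure (ℝ × E)).restrict (Ioo 0 T ×ˢ univ)))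
    (hMv : 0 ≤ Mv) (hMw : 0 ≤ Mw)
    (hvM : ∀ τ ∈ Ioo 0 T, ∀ y, ‖v τ y‖ ≤ Mv) (hwM : ∀ τ ∈ Ioo 0 T, ∀ y, ‖w τ y‖ ≤ Mw) :
    ContDiffOn ℝ ∞ (fun p : ℝ × E => ∫ ξ in Ioo 0 t₁ ×ˢ univ,
      oseenKernel (p.1 - ξ.1) (p.2 - ξ.2) (v ξ.1 ξ.2) (w ξ.1 ξ.2) ∂(volume : Measure (ℝ × E)))
      (Ioi t₁ ×ˢ univ) := by
  obtain ⟨hf, hmeas, hdom⟩ := oseenDuhamelFar_dominated_hypotheses ht₁ ht₁T hv hw hMv hMw hvM hwM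
  exact Literature.Analysis.FunctionSpaces.contDiffOn_integral_of_dominated
    (isOpen_Ioi.prod isOpen_univ) hf hmeas hdom

/-- **The derivatives of the far part are bounded by the integrals of the kernel's**:
`‖D^m Φ₁(p)‖ ≤ ∫_{(0,t₁)×E} ‖D^m_p [K(p.1-τ, p.2-y)[v(τ,y), w(τ,y)]](p)‖ d(τ,y)` for `p.1 > t₁`.
[folklore] -/
theorem norm_iteratedFDeriv_oseenDuhamelFar_le_integral (ht₁ : 0 < t₁) (ht₁T : t₁ ≤ T)
    (hv : AEStronglyMeasurable (uncurry v) ((volume : Measure (ℝ × E)).restrict (Ioo 0 T ×ˢ univ)))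
    (hw : AEStronglyMeasurable (uncurry w) ((volume : Measure (ℝ × E)).restrict (Ioo 0 T ×ˢ univ)))
    (hMv : 0 ≤ Mv) (hMw : 0 ≤ Mw)
    (hvM : ∀ τ ∈ Ioo 0 T, ∀ y, ‖v τ y‖ ≤ Mv) (hwM : ∀ τ ∈ Ioo 0 T, ∀ y, ‖w τ y‖ ≤ Mw)
    (m : ℕ) {p : ℝ × E} (hp : p ∈ Ioi t₁ ×ˢ (univ : Set E)) :
    ‖iteratedFDeriv ℝ m (fun q : ℝ × E => ∫ ξ in Ioo 0 t₁ ×ˢ univ,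
      oseenKernel (q.1 - ξ.1) (q.2 - ξ.2) (v ξ.1 ξ.2) (w ξ.1 ξ.2) ∂(volume : Measure (ℝ × E))) p‖ ≤
      ∫ ξ in Ioo 0 t₁ ×ˢ univ, ‖iteratedFDeriv ℝ m (fun q : ℝ × E =>
        oseenKernel (q.1 - ξ.1) (q.2 - ξ.2) (v ξ.1 ξ.2) (w ξ.1 ξ.2)) p‖ ∂(volume : Measure (ℝ × E)) := by
  obtain ⟨hf, hmeas, hdom⟩ := oseenDuhamelFar_dominated_hypotheses ht₁ ht₁T hv hw hMv hMw hvM hwM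
  exact Literature.Analysis.FunctionSpaces.norm_iteratedFDeriv_integral_le_of_dominated
    (isOpen_Ioi.prod isOpen_univ) hf hmeas hdom m hp

/-- **Explicit bound for the derivatives of the far part**: for every `m` there is `C_m ≥ 0`
(depending only on `m` and `E`) such that for bounded measurable fields on `(0, T) × E`
(bounds `M_v, M_w`), `0 < t₁ ≤ T`, `t₁ < t ≤ 1` and all `x`,
`‖D^m Φ₁(t, x)‖ ≤ C_m M_v M_w t₁ (t - t₁)^{-1/2-m}`
(the kernel's `L¹` bound `∫ ‖D^m K(σ, ·)‖ ≤ C σ^{-1/2-m}`, `σ = t - τ ≥ t - t₁`). With `t₁ = t/2`: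
`t^m ‖D^m Φ₁(t, ·)‖ ≤ 2^{m+1/2} C_m √t M_v M_w`, KNSS's (4.4)–(4.5) for the far part.
[cite: KochNadirashviliSereginSverak2009, §4 (4.4)–(4.5) and Prop. 4.1 (arXiv:0709.3599 p. 8)] -/
theorem exists_norm_iteratedFDeriv_oseenDuhamelFar_le (m : ℕ) :
    ∃ C : ℝ, 0 ≤ C ∧ ∀ {T t₁ Mv Mw : ℝ} {v w : ℝ → E → E}, 0 < t₁ → t₁ ≤ T →
      AEStronglyMeasurable (uncurry v) ((volume : Measure (ℝ × E)).restrict (Ioo 0 T ×ˢ univ)) →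
      AEStronglyMeasurable (uncurry w) ((volume : Measure (ℝ × E)).restrict (Ioo 0 T ×ˢ univ)) →
      0 ≤ Mv → 0 ≤ Mw →
      (∀ τ ∈ Ioo 0 T, ∀ y, ‖v τ y‖ ≤ Mv) → (∀ τ ∈ Ioo 0 T, ∀ y, ‖w τ y‖ ≤ Mw) →
      ∀ ⦃t : ℝ⦄, t₁ < t → t ≤ 1 → ∀ x : E,
        ‖iteratedFDeriv ℝ m (fun q : ℝ × E => ∫ ξ in Ioo 0 t₁ ×ˢ univ,
          oseenKernel (q.1 - ξ.1) (q.2 - ξ.2) (v ξ.1 ξ.2) (w ξ.1 ξ.2) ∂(volume : Measure (ℝ × E)))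
          (t, x)‖ ≤ C * Mv * Mw * t₁ * (t - t₁) ^ (-(1 / 2 : ℝ) - m) := by
  obtain ⟨C, hC0, hL⟩ := exists_integral_norm_iteratedFDeriv_oseenKernelCLM_prod_le_rpow (E := E) m 1
  refine ⟨C, hC0, ?_⟩
  intro T t₁ Mv Mw v w ht₁ ht₁T hv hw hMv hMw hvM hwM t ht₁t ht1 x
  have hp : ((t, x) : ℝ × E) ∈ Ioi t₁ ×ˢ (univ : Set E) := mk_mem_prod ht₁t (mem_univ _)
  obtain ⟨-, hmeas, -⟩ := oseenDuhamelFar_dominated_hypotheses ht₁ ht₁T hv hw hMv hMw hvM hwM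
  refine (norm_iteratedFDeriv_oseenDuhamelFar_le_integral ht₁ ht₁T hv hw hMv hMw hvM hwM m hp).trans ?_
  set S : Set (ℝ × E) := Ioo 0 t₁ ×ˢ univ with hS_def
  have hS : MeasurableSet S := measurableSet_Ioo.prod MeasurableSet.univ
  set F : ℝ × E → ℝ := fun ξ => ‖iteratedFDeriv ℝ m (fun q : ℝ × E =>
    oseenKernel (q.1 - ξ.1) (q.2 - ξ.2) (v ξ.1 ξ.2) (w ξ.1 ξ.2)) (t, x)‖ with hF
  set e : ℝ := -(1 / 2 : ℝ) - m with he
  have he0 : e ≤ 0 := by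
    rw [he]; have : (0 : ℝ) ≤ (m : ℝ) := by positivity
    linarith
  have htt₁ : 0 < t - t₁ := sub_pos.2 ht₁t
  set B : ℝ := C * Mv * Mw * t₁ * (t - t₁) ^ e with hB_def
  have hB : 0 ≤ B := by
    have : 0 ≤ (t - t₁) ^ e := Real.rpow_nonneg htt₁.le _
    positivity
  -- the pointwise bound of the derivative integrand on `S`
  have hpt : ∀ ξ ∈ S, F ξ ≤ Mv * Mw *
      ‖iteratedFDeriv ℝ m (fun r : ℝ × E => oseenKernelCLM r.1 r.2) (t - ξ.1, x - ξ.2)‖ := by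
    intro ξ hξ
    have hξ1 : ξ.1 ∈ Ioo 0 t₁ := (mem_prod.1 hξ).1
    have hq : ((t - ξ.1, x - ξ.2) : ℝ × E) ∈ Ioi (0 : ℝ) ×ˢ (univ : Set E) :=
      mk_mem_prod (mem_Ioi.2 (sub_pos.2 (hξ1.2.trans ht₁t))) (mem_univ _)
    simp only [hF]
    rw [iteratedFDeriv_oseenKernel_translate]
    calc ‖iteratedFDeriv ℝ m (fun r : ℝ × E => oseenKernel r.1 r.2 (v ξ.1 ξ.2) (w ξ.1 ξ.2))
            (t - ξ.1, x - ξ.2)‖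
        ≤ ‖iteratedFDeriv ℝ m (fun r : ℝ × E => oseenKernelCLM r.1 r.2) (t - ξ.1, x - ξ.2)‖ *
            ‖v ξ.1 ξ.2‖ * ‖w ξ.1 ξ.2‖ := norm_iteratedFDeriv_oseenKernel_prod_le_CLM m hq _ _
      _ ≤ ‖iteratedFDeriv ℝ m (fun r : ℝ × E => oseenKernelCLM r.1 r.2) (t - ξ.1, x - ξ.2)‖ *
            Mv * Mw :=
          mul_le_mul (mul_le_mul_of_nonneg_left (hvM ξ.1 (Ioo_subset_Ioo_right ht₁T hξ1) ξ.2)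
            (norm_nonneg _)) (hwM ξ.1 (Ioo_subset_Ioo_right ht₁T hξ1) ξ.2) (norm_nonneg _)
            (mul_nonneg (norm_nonneg _) hMv)
      _ = _ := by ring
  -- the inner `L¹` bounds
  have hinner : ∀ τ ∈ Ioo (0 : ℝ) t₁,
      ∫⁻ y, ENNReal.ofReal (Mv * Mw *
        ‖iteratedFDeriv ℝ m (fun r : ℝ × E => oseenKernelCLM r.1 r.2) (t - τ, y)‖) ≤
        ENNReal.ofReal (Mv * Mw * (C * (t - t₁) ^ e)) := by
    intro τ hτ
    have hσ : t - τ ∈ Ioc (0 : ℝ) 1 := ⟨sub_pos.2 (hτ.2.trans ht₁t), by linarith [hτ.1]⟩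
    obtain ⟨hint, hle⟩ := hL (t - τ) hσ
    have hle' : ∫ y, ‖iteratedFDeriv ℝ m (fun r : ℝ × E => oseenKernelCLM r.1 r.2) (t - τ, y)‖ ≤
        C * (t - t₁) ^ e :=
      hle.trans (mul_le_mul_of_nonneg_left
        (Real.rpow_le_rpow_of_nonpos htt₁ (by linarith [hτ.2]) he0) hC0)
    calc ∫⁻ y, ENNReal.ofReal (Mv * Mw *
          ‖iteratedFDeriv ℝ m (fun r : ℝ × E => oseenKernelCLM r.1 r.2) (t - τ, y)‖)
        = ∫⁻ y, ENNReal.ofReal (Mv * Mw) * ENNReal.ofReal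
            ‖iteratedFDeriv ℝ m (fun r : ℝ × E => oseenKernelCLM r.1 r.2) (t - τ, y)‖ := by
          refine lintegral_congr fun y => ?_
          rw [ENNReal.ofReal_mul (by positivity)]
      _ = ENNReal.ofReal (Mv * Mw) * ∫⁻ y, ENNReal.ofReal
            ‖iteratedFDeriv ℝ m (fun r : ℝ × E => oseenKernelCLM r.1 r.2) (t - τ, y)‖ :=
          lintegral_const_mul' _ _ ENNReal.ofReal_ne_top
      _ = ENNReal.ofReal (Mv * Mw) * ENNReal.ofReal
            (∫ y, ‖iteratedFDeriv ℝ m (fun r : ℝ × E => oseenKernelCLM r.1 r.2) (t - τ, y)‖) := by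
          rw [ofReal_integral_eq_lintegral_ofReal hint.norm (ae_of_all _ fun _ => norm_nonneg _)]
      _ ≤ ENNReal.ofReal (Mv * Mw) * ENNReal.ofReal (C * (t - t₁) ^ e) := by
          gcongr
      _ = ENNReal.ofReal (Mv * Mw * (C * (t - t₁) ^ e)) := by
          rw [← ENNReal.ofReal_mul (by positivity)]
  -- the lintegral bound
  have key : ∫⁻ ξ in S, ENNReal.ofReal (F ξ) ≤ ENNReal.ofReal B := by
    calc ∫⁻ ξ in S, ENNReal.ofReal (F ξ)
        ≤ ∫⁻ ξ in S, ENNReal.ofReal (Mv * Mw *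
            ‖iteratedFDeriv ℝ m (fun r : ℝ × E => oseenKernelCLM r.1 r.2) (t - ξ.1, x - ξ.2)‖) :=
          setLIntegral_mono' hS fun ξ hξ => ENNReal.ofReal_le_ofReal (hpt ξ hξ)
      _ ≤ ∫⁻ τ in Ioo (0 : ℝ) t₁, ∫⁻ y, ENNReal.ofReal (Mv * Mw *
            ‖iteratedFDeriv ℝ m (fun r : ℝ × E => oseenKernelCLM r.1 r.2) (t - τ, x - y)‖) := by
          rw [hS_def, volume_restrict_prod_univ_eq_prod]
          exact lintegral_prod_le _
      _ = ∫⁻ τ in Ioo (0 : ℝ) t₁, ∫⁻ y, ENNReal.ofReal (Mv * Mw *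
            ‖iteratedFDeriv ℝ m (fun r : ℝ × E => oseenKernelCLM r.1 r.2) (t - τ, y)‖) := by
          refine lintegral_congr fun τ => ?_
          exact lintegral_sub_left_eq_self (fun y : E => ENNReal.ofReal (Mv * Mw *
            ‖iteratedFDeriv ℝ m (fun r : ℝ × E => oseenKernelCLM r.1 r.2) (t - τ, y)‖)) x
      _ ≤ ∫⁻ τ in Ioo (0 : ℝ) t₁, ENNReal.ofReal (Mv * Mw * (C * (t - t₁) ^ e)) :=
          setLIntegral_mono' measurableSet_Ioo fun τ hτ => hinner τ hτ
      _ = ENNReal.ofReal (Mv * Mw * (C * (t - t₁) ^ e)) * volume (Ioo (0 : ℝ) t₁) :=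
          setLIntegral_const _ _
      _ = ENNReal.ofReal B := by
          rw [Real.volume_Ioo, sub_zero, ← ENNReal.ofReal_mul (by
            have : 0 ≤ (t - t₁) ^ e := Real.rpow_nonneg htt₁.le _
            positivity)]
          congr 1
          rw [hB_def]; ring
  have hFm : AEStronglyMeasurable F ((volume : Measure (ℝ × E)).restrict S) := (hmeas m _ hp).norm
  rw [integral_eq_lintegral_of_nonneg_ae (ae_of_all _ fun _ => norm_nonneg _) hFm]
  exact ENNReal.toReal_le_of_le_ofReal hB key

end Literature.Analysis.FluidPDE

end
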